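import Summits.BirchSwinnertonDyer.BirchSwinnertonDyer.Theorems.PrintCf2SplitBadTwoLocalPointsScalarAlgebra
import Mathlib.Data.ZMod.QuotientGroup
import HarnessLib

/-!
# Crux `PrintCf2.SplitBadTwoRankOneOfFacts` (stmt-BirchSwinnertonDyer-20368), road α v10.3, S3c bottom value — LOCAL POINTS:
# COUNTING A KUMMER LINE MODULO `p^N` IN A GROUP `G ⊇ ℤ_p` OF FINITE INDEX (pure algebra)

Cell `bsd-print-cf2`, width seat `bsd-line-cf2-p1-w2` g11; `--supports stmt-BirchSwinnertonDyer-20368` (helper, Theses-free).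
HONEST FRAMING: nothing here closes a crux or a stub; BSD is not proved by any of this; no summit statement is proved by this seat.
No definition, no named fact, no `sorry`, no kit. beyond-print theorem: no (bookkeeping).

WHY. The S3c residual (F3) «`v₂ #loc_v(𝔖_{v̄}(K, W*)) = ℓ + e₃([d]₂)`» (cut 13, `restrictedControl_two_of_ptFacts_factor_values`,
hypothesis `hF3`) is computed by the finite-level Poitou–Tate count (-w4 g9 `…SelmerCountAtOnePlace`, p675312) against the DUAL-SIDE
local image at `v`, whose point part is the image of the Mordell–Weil line `ℤ·P + (torsion classes)` in
`E(K_v) ⧸ (2^N E(K_v) + W*(K_v))`, `E(K_v) ⊇ U ≃+ ℤ₂` of finite index (Silverman VII.6.3). This file is the pure algebra of that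
count, for an abstract additive group `G` with a finite-index subgroup `U ≃+ ℤ_p` (currency of -w7 g3's `LocalPointsScalar`):
* `exists_surjective_coord` — a NORMALISED coordinate `ξ : G →+ ℤ_p`, surjective, with kernel the torsion of `G` (so `G/G_tors ≅ ℤ_p`);
* `exists_add_torsion_iff_dvd` — `x ∈ p^j G + G_tors ⟺ p^j ∣ ξ x`; `exists_unit_of_depth` — a point of exact depth `D` has
  `ξ x₀ = p^D · u`, `u` a unit; `exists_depth` — every point of infinite order HAS an exact depth; `pow_dvd_intCast_mul_iff` —
  `p^N ∣ m · p^D u ⟺ p^{N−D} ∣ m` (cf. the tree's coordinate-free law `Rank1Residual.Ordinary.exists_eq_pow_smul_add_torsion_zsmul_iff`);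
* `zsmul_mem_iff_of_depth` — for `x₀` of exact depth `D` and `N ≥ D + a` (with `p^a b`, `p ∤ b`, killing `G_tors`):
  `m x₀ ∈ p^N G + W ⟺ m x₀ ∈ p^N G + G_tors ⟺ p^{N−D} ∣ m`, for any torsion subgroup `W`;
* **`natCard_map_zmultiples_sup_eq`** — THE COUNT: for `K = p^N G + W` (`W` a `p^a`-torsion subgroup), `C` a `p^a`-torsion subgroup with
  `C ⊓ W = ⊥`: `#((ℤx₀ + C) mod K) = p^{N−D} · #C`; with `natCard_sup_of_disjoint` (disjoint finite subgroups of a commutative group).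
On an S3c frame (`G = E(K_v)`, `p = 2`, `x₀ = P`, `W = W*(K_v)`, `C = W*′(K)`, `D = ℓ − [d ≡ 3 (8)]` by -w6 g3
`DyadicTorsion.exists_pow_smul_add_torsion_iff_of_frame`, p675150) this is `#A_N^{pts} = 2^{N−D}·2`, the dual-side factor of (F3).

References: J. H. Silverman, *AEC* 2nd ed. (2009), Prop. VII.6.3 [SilvermanAEC2009]; A. Agboola, Compositio 143 (2007) §6 Prop. 6.10–6.11
[Agboola2007]; J. S. Milne, *Arithmetic Duality Theorems* (2006), I Thm. 4.10 [MilneADT2006].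
-/

noncomputable section

open scoped Classical

set_option linter.dupNamespace false -- `Summit.BirchSwinnertonDyer.BirchSwinnertonDyer` (summit = problem) is the tree's layout
set_option autoImplicit false

namespace Summit.BirchSwinnertonDyer.BirchSwinnertonDyer.Theorems.PrintCf2.LocalLineCount

open Summit.BirchSwinnertonDyer.BirchSwinnertonDyer.Theorems.PrintCf2.LocalPointsScalar

variable {G : Type*} [AddCommGroup G] {p : ℕ} [hp : Fact p.Prime]

/-! ## §1. A normalised `ℤ_p`-coordinate with kernel the torsion -/

/-- **Normalised coordinate.** If `U ≤ G` has finite index and `e : U ≃+ ℤ_p`, there is a SURJECTIVE additive `ξ : G →+ ℤ_p`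
whose kernel is exactly the torsion of `G`; i.e. `G ⧸ G_tors ≃ ℤ_p`. (Rescale -w7 g3's coordinate `exists_coord` by an element of
maximal norm; the image is a fractional ideal `p^{-a} ℤ_p`.) [folklore] [cite: SilvermanAEC2009, Prop. VII.6.3] -/
theorem exists_surjective_coord (U : AddSubgroup G) [U.FiniteIndex] (e : U ≃+ ℤ_[p]) :
    ∃ ξ : G →+ ℤ_[p], Function.Surjective ξ ∧ ∀ x, ξ x = 0 ↔ IsOfFinAddOrder x := by
  obtain ⟨ξ₀, hker, hU, hbd, hmod⟩ := exists_coord U e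
  have hp1 : 1 < (p : ℝ) := by exact_mod_cast hp.out.one_lt
  have hp0 : 0 < (p : ℝ) := lt_trans zero_lt_one hp1
  -- the natural exponents `n` with `‖ξ₀ x‖ = p^n` for some `x`
  set T : Set ℕ := {n | ∃ x, ‖ξ₀ x‖ = (p : ℝ) ^ n} with hT
  have hT0 : (0 : ℕ) ∈ T := by
    refine ⟨((e.symm 1 : U) : G), ?_⟩
    rw [hU, AddEquiv.apply_symm_apply, PadicInt.coe_one, norm_one, pow_zero]
  obtain ⟨B, hB⟩ := pow_unbounded_of_one_lt ‖((U.index : ℕ) : ℚ_[p])‖⁻¹ hp1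
  have hTbdd : BddAbove T := by
    refine ⟨B, fun n hn ↦ ?_⟩
    obtain ⟨x, hx⟩ := hn
    have h1 : (p : ℝ) ^ n < (p : ℝ) ^ B := by
      rw [← hx]; exact lt_of_le_of_lt (hbd x) hB
    exact le_of_lt ((pow_lt_pow_iff_right₀ hp1).mp h1)
  obtain ⟨x₁, hx₁⟩ : sSup T ∈ T := Nat.sSup_mem ⟨0, hT0⟩ hTbdd
  -- maximality of `‖ξ₀ x₁‖`
  have hmax : ∀ x, ‖ξ₀ x‖ ≤ (p : ℝ) ^ sSup T := by
    intro x
    by_cases hx0 : ξ₀ x = 0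
    · rw [hx0, norm_zero]; positivity
    have hnx := Padic.norm_eq_zpow_neg_valuation hx0
    by_cases hv : 0 ≤ (ξ₀ x).valuation
    · calc ‖ξ₀ x‖ = (p : ℝ) ^ (-(ξ₀ x).valuation) := hnx
        _ ≤ (p : ℝ) ^ (0 : ℤ) := zpow_le_zpow_right₀ hp1.le (by omega)
        _ ≤ (p : ℝ) ^ sSup T := by rw [zpow_zero]; exact one_le_pow₀ hp1.le
    · have hk : ∃ k : ℕ, -(ξ₀ x).valuation = (k : ℤ) := ⟨(-(ξ₀ x).valuation).toNat, by omega⟩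
      obtain ⟨k, hk⟩ := hk
      have hxk : ‖ξ₀ x‖ = (p : ℝ) ^ k := by rw [hnx, hk, zpow_natCast]
      have hkT : k ∈ T := ⟨x, hxk⟩
      rw [hxk]
      exact pow_le_pow_right₀ hp1.le (le_csSup hTbdd hkT)
  set c : ℚ_[p] := ξ₀ x₁ with hc
  have hcn : ‖c‖ = (p : ℝ) ^ sSup T := hx₁
  have hc0 : c ≠ 0 := by
    intro h; rw [h, norm_zero] at hcn; exact (ne_of_gt (pow_pos hp0 _)) hcn.symm
  have hle : ∀ x, ‖ξ₀ x / c‖ ≤ 1 := by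
    intro x
    rw [norm_div, div_le_one (by rw [hcn]; positivity), hcn]
    exact hmax x
  let ξ : G →+ ℤ_[p] :=
    { toFun := fun x ↦ ⟨ξ₀ x / c, hle x⟩
      map_zero' := by
        apply PadicInt.ext
        show ξ₀ 0 / c = ((0 : ℤ_[p]) : ℚ_[p])
        rw [map_zero, zero_div, PadicInt.coe_zero]
      map_add' := fun x y ↦ by
        apply PadicInt.ext
        rw [PadicInt.coe_add]
        show ξ₀ (x + y) / c = ξ₀ x / c + ξ₀ y / c
        rw [map_add, add_div] }
  have hξ : ∀ x, ((ξ x : ℤ_[p]) : ℚ_[p]) = ξ₀ x / c := fun _ ↦ rfl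
  refine ⟨ξ, fun t ↦ ?_, fun x ↦ ?_⟩
  · obtain ⟨x', hx'⟩ := hmod x₁ t
    refine ⟨x', PadicInt.ext ?_⟩
    rw [hξ, hx', ← hc, mul_div_cancel_right₀ _ hc0]
  · rw [← hker x]
    constructor
    · intro h
      have h1 : ξ₀ x / c = 0 := by rw [← hξ, h, PadicInt.coe_zero]
      rcases div_eq_zero_iff.mp h1 with h2 | h2
      · exact h2
      · exact absurd h2 hc0
    · intro h
      apply PadicInt.ext
      rw [hξ, h, zero_div, PadicInt.coe_zero]

/-! ## §2. Depth calculus along the coordinate -/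

section Depth

variable {ξ : G →+ ℤ_[p]}

/-- `x ∈ p^j G + G_tors ⟺ p^j ∣ ξ x` for a surjective coordinate with kernel the torsion. [folklore] -/
theorem exists_add_torsion_iff_dvd (hsurj : Function.Surjective ξ) (hker : ∀ x, ξ x = 0 ↔ IsOfFinAddOrder x)
    (x : G) (j : ℕ) :
    (∃ y t : G, IsOfFinAddOrder t ∧ p ^ j • y + t = x) ↔ (p : ℤ_[p]) ^ j ∣ ξ x := by
  constructor
  · rintro ⟨y, t, ht, rfl⟩
    refine ⟨ξ y, ?_⟩
    rw [map_add, (hker t).mpr ht, add_zero, map_nsmul, nsmul_eq_mul, Nat.cast_pow]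
  · rintro ⟨s, hs⟩
    obtain ⟨y, rfl⟩ := hsurj s
    refine ⟨y, x - p ^ j • y, (hker _).mp ?_, by abel⟩
    rw [map_sub, map_nsmul, nsmul_eq_mul, Nat.cast_pow, hs, sub_self]

/-- A point of EXACT depth `D` (`x₀ ∈ p^D G + G_tors`, `x₀ ∉ p^{D+1} G + G_tors`) has coordinate `ξ x₀ = p^D · u` with `u` a unit.
[folklore] -/
theorem exists_unit_of_depth (hsurj : Function.Surjective ξ) (hker : ∀ x, ξ x = 0 ↔ IsOfFinAddOrder x)
    {x₀ : G} {D : ℕ}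
    (hD : ∃ y t : G, IsOfFinAddOrder t ∧ p ^ D • y + t = x₀)
    (hD' : ¬ ∃ y t : G, IsOfFinAddOrder t ∧ p ^ (D + 1) • y + t = x₀) :
    ∃ u : ℤ_[p], IsUnit u ∧ ξ x₀ = (p : ℤ_[p]) ^ D * u := by
  obtain ⟨u, hu⟩ := (exists_add_torsion_iff_dvd hsurj hker x₀ D).mp hD
  refine ⟨u, ?_, hu⟩
  rw [PadicInt.isUnit_iff]
  refine le_antisymm (PadicInt.norm_le_one u) (not_lt.mp fun hlt ↦ hD' ?_)
  rw [PadicInt.norm_lt_one_iff_dvd] at hlt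
  obtain ⟨w, rfl⟩ := hlt
  exact (exists_add_torsion_iff_dvd hsurj hker x₀ (D + 1)).mpr ⟨w, by rw [hu]; ring⟩

/-- **Every point of infinite order has an exact depth**: if `x₀ ∈ G ⊇ U ≃+ ℤ_p` is not torsion, there is `D` with
`x₀ ∈ p^D G + G_tors` and `x₀ ∉ p^{D+1} G + G_tors` (`D` = the valuation of the coordinate `ξ x₀ ≠ 0`). [folklore] -/
theorem exists_depth (hsurj : Function.Surjective ξ) (hker : ∀ x, ξ x = 0 ↔ IsOfFinAddOrder x)
    {x₀ : G} (hx₀ : ¬ IsOfFinAddOrder x₀) :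
    ∃ D : ℕ, (∃ y t : G, IsOfFinAddOrder t ∧ p ^ D • y + t = x₀) ∧
      ¬ ∃ y t : G, IsOfFinAddOrder t ∧ p ^ (D + 1) • y + t = x₀ := by
  have hξ0 : ξ x₀ ≠ 0 := fun h ↦ hx₀ ((hker x₀).mp h)
  refine ⟨(ξ x₀).valuation, (exists_add_torsion_iff_dvd hsurj hker x₀ _).mpr
    ⟨(PadicInt.unitCoeff hξ0 : ℤ_[p]), by rw [mul_comm]; exact PadicInt.unitCoeff_spec hξ0⟩, fun h ↦ ?_⟩
  obtain ⟨w, hw⟩ := (exists_add_torsion_iff_dvd hsurj hker x₀ _).mp h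
  have hpD : (p : ℤ_[p]) ^ (ξ x₀).valuation ≠ 0 := pow_ne_zero _ (by exact_mod_cast hp.out.ne_zero)
  have hunit : (p : ℤ_[p]) ∣ (PadicInt.unitCoeff hξ0 : ℤ_[p]) := by
    refine ⟨w, mul_left_cancel₀ hpD ?_⟩
    rw [← mul_assoc, ← pow_succ, ← hw, mul_comm]
    exact (PadicInt.unitCoeff_spec hξ0).symm
  have hlt : ‖((PadicInt.unitCoeff hξ0 : ℤ_[p]ˣ) : ℤ_[p])‖ < 1 := (PadicInt.norm_lt_one_iff_dvd _).mpr hunit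
  have heq : ‖((PadicInt.unitCoeff hξ0 : ℤ_[p]ˣ) : ℤ_[p])‖ = 1 := PadicInt.isUnit_iff.mp (Units.isUnit _)
  exact (ne_of_lt hlt) heq

omit [AddCommGroup G] in
/-- `p^N ∣ m · (p^D · u) ⟺ p^{N−D} ∣ m` (`u` a unit, `D ≤ N`, `m ∈ ℤ`). [folklore] -/
theorem pow_dvd_intCast_mul_iff {u : ℤ_[p]} (hu : IsUnit u) {D N : ℕ} (hDN : D ≤ N) (m : ℤ) :
    (p : ℤ_[p]) ^ N ∣ (m : ℤ_[p]) * ((p : ℤ_[p]) ^ D * u) ↔ ((p : ℤ) ^ (N - D)) ∣ m := by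
  obtain ⟨u, rfl⟩ := hu
  have hpD : (p : ℤ_[p]) ^ D ≠ 0 := pow_ne_zero _ (by exact_mod_cast hp.out.ne_zero)
  rw [← mul_assoc, Units.dvd_mul_right, show (p : ℤ_[p]) ^ N = (p : ℤ_[p]) ^ (N - D) * (p : ℤ_[p]) ^ D by
    rw [← pow_add, Nat.sub_add_cancel hDN], mul_dvd_mul_iff_right hpD, PadicInt.pow_p_dvd_int_iff]

/-- **Membership of multiples modulo `p^N G + torsion`**: if `x₀` has exact depth `D`, then for `N ≥ D`,
`m x₀ ∈ p^N G + G_tors ⟺ p^{N−D} ∣ m`. [folklore] -/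
theorem exists_add_torsion_zsmul_iff (hsurj : Function.Surjective ξ) (hker : ∀ x, ξ x = 0 ↔ IsOfFinAddOrder x)
    {x₀ : G} {D N : ℕ} (hDN : D ≤ N)
    (hD : ∃ y t : G, IsOfFinAddOrder t ∧ p ^ D • y + t = x₀)
    (hD' : ¬ ∃ y t : G, IsOfFinAddOrder t ∧ p ^ (D + 1) • y + t = x₀) (m : ℤ) :
    (∃ y t : G, IsOfFinAddOrder t ∧ p ^ N • y + t = m • x₀) ↔ ((p : ℤ) ^ (N - D)) ∣ m := by
  obtain ⟨u, hu, hx₀⟩ := exists_unit_of_depth hsurj hker hD hD'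
  rw [exists_add_torsion_iff_dvd hsurj hker, map_zsmul, zsmul_eq_mul, hx₀]
  exact pow_dvd_intCast_mul_iff hu hDN m

end Depth

/-! ## §3. Torsion bookkeeping -/

/-- The torsion of `G ⊇ U ≃+ ℤ_p` (finite index) is killed by the index `[G : U]` (it embeds in `G ⧸ U`). [folklore] -/
theorem index_nsmul_eq_zero_of_isOfFinAddOrder (U : AddSubgroup G) [U.FiniteIndex] (e : U ≃+ ℤ_[p]) {t : G}
    (ht : IsOfFinAddOrder t) : U.index • t = 0 := by
  have hmem : U.index • t ∈ U := U.nsmul_index_mem t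
  obtain ⟨n, hn, hnt⟩ := isOfFinAddOrder_iff_nsmul_eq_zero.mp ht
  have h1 : n • (⟨U.index • t, hmem⟩ : U) = 0 := by
    apply Subtype.ext
    rw [AddSubgroupClass.coe_nsmul, ZeroMemClass.coe_zero, smul_comm, hnt, smul_zero]
  have h2 : n • e ⟨U.index • t, hmem⟩ = 0 := by rw [← map_nsmul, h1, map_zero]
  have h3 : e ⟨U.index • t, hmem⟩ = 0 := by
    rcases smul_eq_zero.mp h2 with h | h
    · exact absurd h (Nat.pos_iff_ne_zero.mp hn)
    · exact h
  have h4 : (⟨U.index • t, hmem⟩ : U) = 0 := by simpa using h3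
  exact congrArg Subtype.val h4

/-- There are `a`, `b` with `p ∤ b` such that `p^a · b` kills every torsion element of `G ⊇ U ≃+ ℤ_p`. [folklore] -/
theorem exists_torsion_annihilator (U : AddSubgroup G) [U.FiniteIndex] (e : U ≃+ ℤ_[p]) :
    ∃ a b : ℕ, ¬ p ∣ b ∧ ∀ t : G, IsOfFinAddOrder t → (p ^ a * b) • t = 0 := by
  obtain ⟨a, b, hb, hab⟩ := Nat.exists_eq_pow_mul_and_not_dvd (AddSubgroup.FiniteIndex.index_ne_zero (H := U)) p hp.out.ne_one
  exact ⟨a, b, hb, fun t ht ↦ by rw [← hab]; exact index_nsmul_eq_zero_of_isOfFinAddOrder U e ht⟩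

/-! ## §4. The count modulo `K = p^N G + W` -/

/-- Two DISJOINT subgroups of a commutative group span a subgroup of cardinality the product (`Nat.card`, so also for infinite
ones with the convention `0`). [folklore] -/
theorem natCard_sup_of_disjoint {A : Type*} [AddCommGroup A] (H₁ H₂ : AddSubgroup A) (h : Disjoint H₁ H₂) :
    Nat.card ↥(H₁ ⊔ H₂) = Nat.card H₁ * Nat.card H₂ := by
  let f : H₁ × H₂ → A := fun g ↦ (g.1 : A) + g.2
  have hf : Function.Injective f := AddSubgroup.add_injective_of_disjoint h
  have hrange : Set.range f = ((H₁ ⊔ H₂ : AddSubgroup A) : Set A) := by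
    ext x
    simp only [Set.mem_range, SetLike.mem_coe, AddSubgroup.mem_sup, f, Prod.exists]
    constructor
    · rintro ⟨a, b, rfl⟩
      exact ⟨a, a.2, b, b.2, rfl⟩
    · rintro ⟨y, hy, z, hz, rfl⟩
      exact ⟨⟨y, hy⟩, ⟨z, hz⟩, rfl⟩
  calc Nat.card ↥(H₁ ⊔ H₂) = Nat.card (Set.range f) := by rw [hrange]; rfl
    _ = Nat.card (H₁ × H₂) := Nat.card_range_of_injective hf
    _ = Nat.card H₁ * Nat.card H₂ := Nat.card_prod _ _

/-- An element killed by `b` with `p ∤ b` is a `p^N`-th multiple (Bézout). [folklore] -/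
theorem exists_pow_nsmul_eq_of_nsmul_eq_zero {b : ℕ} (hb : ¬ p ∣ b) (N : ℕ) {z : G} (hz : b • z = 0) :
    ∃ y : G, p ^ N • y = z := by
  have hcop : IsCoprime ((p ^ N : ℕ) : ℤ) (b : ℤ) :=
    Nat.isCoprime_iff_coprime.mpr ((hp.out.coprime_iff_not_dvd.mpr hb).pow_left N)
  obtain ⟨u, v, huv⟩ := hcop
  refine ⟨u • z, ?_⟩
  have hz' : (b : ℤ) • z = 0 := by rw [natCast_zsmul, hz]
  calc p ^ N • (u • z) = ((p ^ N : ℕ) : ℤ) • (u • z) := (natCast_zsmul _ _).symm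
    _ = (u * ((p ^ N : ℕ) : ℤ)) • z + v • ((b : ℤ) • z) := by rw [hz', smul_zero, add_zero, mul_comm, mul_smul]
    _ = (u * ((p ^ N : ℕ) : ℤ) + v * (b : ℤ)) • z := by rw [add_smul, mul_smul v]
    _ = z := by rw [huv, one_smul]

/-- An element killed by `p^a` and by `b` with `p ∤ b` is zero. [folklore] -/
theorem eq_zero_of_pow_nsmul_of_nsmul {a b : ℕ} (hb : ¬ p ∣ b) {z : G} (hpa : p ^ a • z = 0) (hbz : b • z = 0) : z = 0 := by
  have hcop : IsCoprime ((p ^ a : ℕ) : ℤ) (b : ℤ) :=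
    Nat.isCoprime_iff_coprime.mpr ((hp.out.coprime_iff_not_dvd.mpr hb).pow_left a)
  obtain ⟨u, v, huv⟩ := hcop
  have h1 : ((p ^ a : ℕ) : ℤ) • z = 0 := by rw [natCast_zsmul, hpa]
  have h2 : (b : ℤ) • z = 0 := by rw [natCast_zsmul, hbz]
  calc z = (u * ((p ^ a : ℕ) : ℤ) + v * (b : ℤ)) • z := by rw [huv, one_smul]
    _ = 0 := by rw [add_smul, mul_smul, mul_smul, h1, h2, smul_zero, smul_zero, add_zero]

/-- **Multiples of `x₀` modulo `K = p^N G + W`.** Let `G ⊇ U ≃+ ℤ_p` (finite index), `p^a · b` (`p ∤ b`) kill the torsion of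
`G`, `x₀` of exact depth `D`, `N ≥ D + a`, `W` a torsion subgroup and `K = p^N G + W`. Then `m • x₀ ∈ K ⟺ p^{N−D} ∣ m`: the class of
`x₀` in `G ⧸ K` has order exactly `p^{N−D}`. [folklore] [cite: SilvermanAEC2009, Prop. VII.6.3] -/
theorem zsmul_mem_iff_of_depth (U : AddSubgroup G) [U.FiniteIndex] (e : U ≃+ ℤ_[p])
    {a b : ℕ} (hb : ¬ p ∣ b) (htors : ∀ t : G, IsOfFinAddOrder t → (p ^ a * b) • t = 0)
    {x₀ : G} {D N : ℕ} (hN : D + a ≤ N)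
    (hD : ∃ y t : G, IsOfFinAddOrder t ∧ p ^ D • y + t = x₀)
    (hD' : ¬ ∃ y t : G, IsOfFinAddOrder t ∧ p ^ (D + 1) • y + t = x₀)
    (W K : AddSubgroup G) (hW : ∀ w ∈ W, IsOfFinAddOrder w)
    (hK : ∀ k, k ∈ K ↔ ∃ y w : G, w ∈ W ∧ p ^ N • y + w = k) (m : ℤ) :
    m • x₀ ∈ K ↔ ((p : ℤ) ^ (N - D)) ∣ m := by
  obtain ⟨ξ, hsurj, hker⟩ := exists_surjective_coord U e
  have hDN : D ≤ N := le_trans (Nat.le_add_right D a) hN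
  constructor
  · intro hm
    obtain ⟨y, w, hw, hyw⟩ := (hK _).mp hm
    exact (exists_add_torsion_zsmul_iff hsurj hker hDN hD hD' m).mp ⟨y, w, hW w hw, hyw⟩
  · rintro ⟨m', rfl⟩
    obtain ⟨y₀, t₀, ht₀, hx₀⟩ := hD
    -- `p^{N-D} t₀ ∈ p^N G`
    have hz : b • (p ^ (N - D) • t₀) = 0 := by
      have h1 : p ^ (N - D) • t₀ = p ^ (N - D - a) • (p ^ a • t₀) := by
        rw [← mul_nsmul', ← pow_add, Nat.sub_add_cancel (by omega)]
      rw [h1, smul_comm b (p ^ (N - D - a)) (p ^ a • t₀), ← mul_nsmul' t₀ b (p ^ a), mul_comm b (p ^ a),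
        htors t₀ ht₀, smul_zero]
    obtain ⟨y₁, hy₁⟩ := exists_pow_nsmul_eq_of_nsmul_eq_zero hb N hz
    have h2 : ((p : ℤ) ^ (N - D)) • x₀ = p ^ N • y₀ + p ^ (N - D) • t₀ := by
      rw [← Nat.cast_pow, natCast_zsmul, ← hx₀, smul_add, ← mul_nsmul', ← pow_add, Nat.sub_add_cancel hDN]
    have hkey : ((p : ℤ) ^ (N - D) * m') • x₀ = p ^ N • (m' • (y₀ + y₁)) := by
      rw [mul_comm, mul_smul, h2, ← hy₁, ← smul_add, smul_comm]
    refine (hK _).mpr ⟨m' • (y₀ + y₁), 0, W.zero_mem, ?_⟩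
    rw [add_zero, hkey]

/-- **THE COUNT.** Let `G ⊇ U ≃+ ℤ_p` (finite index), `p^a · b` (`p ∤ b`) kill the torsion of `G`, `x₀ ∈ G` of exact depth `D`
(`x₀ ∈ p^D G + G_tors ∖ p^{D+1} G + G_tors`), `N ≥ D + a`. Let `W, C ≤ G` be `p^a`-torsion subgroups with `C ⊓ W = ⊥`, and
`K = p^N G + W`. Then the image of `ℤ·x₀ + C` in `G ⧸ K` has exactly `p^{N−D} · #C` elements (the class of `x₀` has order `p^{N−D}`,
meets the image of `C` trivially, and `C` injects). On an S3c frame: `G = E(K_v) ≃ E(ℚ₂)`, `x₀ = P`, `W = W*(K_v)`, `C = W*′(K)`,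
`D = ℓ − [d ≡ 3 (8)]` — the point part `A_N^{pts}` of the dual-side local image of (F3). [folklore]
[cite: SilvermanAEC2009, Prop. VII.6.3] [cite: Agboola2007, §6 Prop. 6.10–6.11] -/
theorem natCard_map_zmultiples_sup_eq (U : AddSubgroup G) [U.FiniteIndex] (e : U ≃+ ℤ_[p])
    {a b : ℕ} (hb : ¬ p ∣ b) (htors : ∀ t : G, IsOfFinAddOrder t → (p ^ a * b) • t = 0)
    {x₀ : G} {D N : ℕ} (hN : D + a ≤ N)
    (hD : ∃ y t : G, IsOfFinAddOrder t ∧ p ^ D • y + t = x₀)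
    (hD' : ¬ ∃ y t : G, IsOfFinAddOrder t ∧ p ^ (D + 1) • y + t = x₀)
    (W C K : AddSubgroup G) (hW : ∀ w ∈ W, p ^ a • w = 0) (hC : ∀ c ∈ C, p ^ a • c = 0) (hCW : Disjoint C W)
    (hK : ∀ k, k ∈ K ↔ ∃ y w : G, w ∈ W ∧ p ^ N • y + w = k) :
    Nat.card ↥((AddSubgroup.zmultiples x₀ ⊔ C).map (QuotientAddGroup.mk' K)) = p ^ (N - D) * Nat.card C := by
  obtain ⟨ξ, hsurj, hker⟩ := exists_surjective_coord U e
  have hpa0 : p ^ a ≠ 0 := pow_ne_zero _ hp.out.ne_zero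
  have hpN0 : p ^ N ≠ 0 := pow_ne_zero _ hp.out.ne_zero
  have hWt : ∀ w ∈ W, IsOfFinAddOrder w := fun w hw ↦
    isOfFinAddOrder_iff_nsmul_eq_zero.mpr ⟨p ^ a, Nat.pos_of_ne_zero hpa0, hW w hw⟩
  have hCt : ∀ c ∈ C, IsOfFinAddOrder c := fun c hc ↦
    isOfFinAddOrder_iff_nsmul_eq_zero.mpr ⟨p ^ a, Nat.pos_of_ne_zero hpa0, hC c hc⟩
  have hDN : D ≤ N := le_trans (Nat.le_add_right D a) hN
  -- (A) `m x₀ - c ∈ K` with `c ∈ C` forces `p^{N-D} ∣ m`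
  have hA : ∀ (m : ℤ), ∀ c ∈ C, m • x₀ - c ∈ K → ((p : ℤ) ^ (N - D)) ∣ m := by
    intro m c hc hmc
    obtain ⟨y, w, hw, hyw⟩ := (hK _).mp hmc
    refine (exists_add_torsion_zsmul_iff hsurj hker hDN hD hD' m).mp ⟨y, w + c, (hWt w hw).add (hCt c hc), ?_⟩
    rw [← add_assoc, hyw, sub_add_cancel]
  -- (B) `p^{N-D} ∣ m` forces `m x₀ ∈ K`
  have hB : ∀ m : ℤ, ((p : ℤ) ^ (N - D)) ∣ m → m • x₀ ∈ K := fun m hm ↦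
    (zsmul_mem_iff_of_depth U e hb htors hN hD hD' W K hWt hK m).mpr hm
  -- (C) `C` meets `K` trivially
  have hCK : ∀ c ∈ C, c ∈ K → c = 0 := by
    intro c hc hcK
    obtain ⟨y, w, hw, hyw⟩ := (hK _).mp hcK
    have hcw : c - w = p ^ N • y := by rw [← hyw]; abel
    have hyt : IsOfFinAddOrder y := by
      refine IsOfFinAddOrder.of_nsmul ?_ hpN0
      rw [← hcw, sub_eq_add_neg]; exact (hCt c hc).add (isOfFinAddOrder_neg_iff.mpr (hWt w hw))
    have hb0 : b • (c - w) = 0 := by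
      rw [hcw, show p ^ N • y = p ^ (N - a) • (p ^ a • y) by
        rw [← mul_nsmul', ← pow_add, Nat.sub_add_cancel (by omega)], smul_comm b (p ^ (N - a)) (p ^ a • y),
        ← mul_nsmul' y b (p ^ a), mul_comm b (p ^ a), htors y hyt, smul_zero]
    have hp0 : p ^ a • (c - w) = 0 := by rw [smul_sub, hC c hc, hW w hw, sub_zero]
    have hcw0 : c - w = 0 := eq_zero_of_pow_nsmul_of_nsmul hb hp0 hb0
    have hcw' : c = w := sub_eq_zero.mp hcw0
    have hcW : c ∈ W := hcw' ▸ hw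
    exact (AddSubgroup.disjoint_def.mp hCW) hc hcW
  -- assemble
  set π := QuotientAddGroup.mk' K with hπ
  have hπker : ∀ g : G, π g = 0 ↔ g ∈ K := fun g ↦ by
    rw [hπ, ← AddMonoidHom.mem_ker, QuotientAddGroup.ker_mk']
  rw [AddSubgroup.map_sup, AddMonoidHom.map_zmultiples]
  -- order of the class of `x₀`
  have hord : addOrderOf (π x₀) = p ^ (N - D) := by
    refine Nat.dvd_antisymm ?_ ?_
    · refine addOrderOf_dvd_of_nsmul_eq_zero ?_
      rw [← map_nsmul, hπker, ← natCast_zsmul]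
      exact hB _ ⟨1, by push_cast; ring⟩
    · have h1 : (addOrderOf (π x₀) : ℤ) • x₀ ∈ K := by
        rw [natCast_zsmul, ← hπker, map_nsmul, addOrderOf_nsmul_eq_zero]
      have h2 := hA (addOrderOf (π x₀)) 0 C.zero_mem (by rw [sub_zero]; exact h1)
      exact_mod_cast h2
  -- disjointness of the two images
  have hdisj : Disjoint (AddSubgroup.zmultiples (π x₀)) (C.map π) := by
    rw [AddSubgroup.disjoint_def]
    rintro g hg₁ hg₂
    obtain ⟨m, rfl⟩ := AddSubgroup.mem_zmultiples_iff.mp hg₁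
    obtain ⟨c, hc, hcm⟩ := AddSubgroup.mem_map.mp hg₂
    have hmc : m • x₀ - c ∈ K := by
      rw [← hπker, map_sub, map_zsmul, hcm, sub_self]
    have hm := hA m c hc hmc
    show m • π x₀ = 0
    rw [← map_zsmul, hπker]
    exact hB m hm
  -- `C` injects
  have hinj : Set.InjOn π (C : Set G) := by
    intro c₁ hc₁ c₂ hc₂ h12
    have hsub : c₁ - c₂ ∈ K := by rw [← hπker, map_sub, h12, sub_self]
    exact sub_eq_zero.mp (hCK _ (C.sub_mem hc₁ hc₂) hsub)
  have hcardC : Nat.card ↥(C.map π) = Nat.card C := by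
    have e1 : Nat.card ↥(C.map π) = (π '' (C : Set G)).ncard := by
      rw [← AddSubgroup.coe_map]; exact Nat.card_coe_set_eq _
    have e2 : Nat.card ↥C = (C : Set G).ncard := Nat.card_coe_set_eq _
    rw [e1, e2, Set.InjOn.ncard_image hinj]
  rw [natCard_sup_of_disjoint _ _ hdisj, Nat.card_zmultiples, hord, hcardC]

end Summit.BirchSwinnertonDyer.BirchSwinnertonDyer.Theorems.PrintCf2.LocalLineCount

end
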